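import Literature.Barriers.RiemannHypothesis.EpsteinZetaRealZeros
import Literature.NumberTheory.Automorphic.ModularEisensteinContinuation
import HarnessLib

/-!
# Discharge of `MontgomeryVaughan2007_epsteinContinuation` (continuation and functional equation of the Epstein zeta function of a positive definite binary form)

Sibling of `Literature/Barriers/RiemannHypothesis/EpsteinZetaRealZeros.lean`, whose named fact
`Literature.Barriers.RiemannHypothesis.MontgomeryVaughan2007_epsteinContinuation` (Montgomery–Vaughan,
*Multiplicative Number Theory I*, §10.1 Exercise 25 (d), (e)) asserts: for `Q = ax² + bxy + cy²`
positive definite (`a > 0`, `d = b² − 4ac < 0`) there is a function `Z`, holomorphic on `ℂ ∖ {1}`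
and equal to `ζ_Q(s) = ∑_{(m,n) ≠ 0} Q(m,n)^{−s}` for `σ > 1`, whose completion
`ξ_Q(s) = Z(s) Γ(s) (−d)^{s/2} (2π)^{−s}` satisfies `ξ_Q(s) = ξ_Q(1 − s)` at every non-integer `s`.
This file PROVES it (`MontgomeryVaughan2007_epsteinContinuation_holds`).

## The printed proof (MV §10.1 Exercise 25 (a)–(e), PDF pp. 262–263) and the proof given here

MV: put `ϑ_Q(z) = ∑_{m,n} e^{−2πQ(m,n)z/√(−d)}`; (a) complete the square,
`ϑ_Q(z) = ∑_n e^{−πzn²√(−d)/(2a)} ∑_m e^{−2πa(m + bn/2a)²z/√(−d)}`; (b) apply the theta transformation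
formula (Theorem 10.1) to the inner sum, take the sum over `n` inside, and apply Theorem 10.1 a
second time: `ϑ_Q(z) = ϑ_Q(1/z)/z`; (c) split the Mellin integral of `ϑ_Q − 1` at `z` (incomplete
gamma functions); (d) hence `ζ_Q` is meromorphic with only a simple pole at `s = 1`; (e)
`ξ_Q(s) = ξ_Q(1 − s)`.

Here steps (a)–(b) are not redone: with `D = −d = 4ac − b²` and the point
`z_Q = (b + i√D)/(2c) ∈ ℍ` one has the identity of forms
`Q(m, n) = (√D/2) · |m z_Q + n|²/Im z_Q = (√D/2) · Q_{z_Q}(m, n)` (`bqfEval_eq_mul_qForm`), so that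
MV's `ϑ_Q(t)` is *literally* the theta series `Θ_{z_Q}(t) = ∑_{(c,d)} e^{−πt|cz+d|²/y}` of the
lattice `ℤ z_Q + ℤ` treated (and proved to satisfy `Θ_z(1/t) = t Θ_z(t)`, by the same double
application of the one-variable theta transformation) in
`Literature/NumberTheory/Automorphic/ModularEisensteinContinuation.lean` (`Literature.NumberTheory.Automorphic.thetaQ`,
`Literature.NumberTheory.Automorphic.thetaQ_functional_equation`, `Literature.thetaFEPair z : WeakFEPair ℂ` with `k = 1`, `ε = 1`,
`f₀ = g₀ = 1`). Step (c) is Mathlib's Mellin machinery for weak FE-pairs (`WeakFEPair.Λ`, entire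
off `{0, 1}`, `Λ(1 − s) = Λ(s)`), and the Mellin transform of `Θ_z − 1` is computed termwise
(`hasSum_mellin_pi_mul₀`): `Λ_z(s) = π^{−s} Γ(s) ∑_{v ≠ 0} Q_z(v)^{−s} = π^{−s} Γ(s) (√D/2)^s ζ_Q(s)`
for `σ > 1` (`thetaFEPair_Λ_eq_tsum`, `thetaFEPair_Λ_eq_epsteinZeta`). The continuation is
`Z(s) = π^s (√D/2)^{−s} [(Λ₀(s) − 1/(1−s)) Γ(s)⁻¹ − Γ(s+1)⁻¹]`, where `Λ = Λ₀ − 1/s − 1/(1−s)` with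
`Λ₀` entire and `1/(sΓ(s)) = 1/Γ(s+1)` removes the apparent singularity at `s = 0` (so `Z` is
holomorphic on `ℂ ∖ {1}`, (d)); for `Γ(s) ≠ 0`, `Z(s)Γ(s)D^{s/2}(2π)^{−s} = Λ_z(s)` because
`π^s (√D/2)^{−s} D^{s/2} (2π)^{−s} = 1` (`cpow_normalisation`), whence (e) at all non-integers.

## References

* [MontgomeryVaughan2007] H. L. Montgomery, R. C. Vaughan, *Multiplicative Number Theory I.
  Classical Theory*, CUP 2007, §10.1 Exercise 25 (a)–(e) (PDF pp. 262–263 of the held copy, read).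
* [Iwaniec2002] H. Iwaniec, *Spectral Methods of Automorphic Forms*, §3.4 (the source followed by
  `ModularEisensteinContinuation.lean` for `Θ_z` and `Λ_z`).
-/

noncomputable section

open Complex Filter Topology
open scoped UpperHalfPlane

namespace Literature.Barriers.RiemannHypothesis

variable {a b c : ℝ}

/-! ## The form `Q` as a multiple of `Q_z`, `z = (b + i√D)/(2c)` -/

/-- `D = 4ac − b² = −d > 0` for a positive definite form. [folklore] -/
theorem IsPosDefForm.four_ac_sub_sq_pos (h : IsPosDefForm a b c) : 0 < 4 * a * c - b ^ 2 := by
  have := h.disc_neg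
  linarith

/-- `√D/(2c) > 0`, so `z_Q = (b + i√D)/(2c)` lies in the upper half-plane. [folklore] -/
theorem IsPosDefForm.sqrt_div_pos (h : IsPosDefForm a b c) :
    0 < Real.sqrt (4 * a * c - b ^ 2) / (2 * c) :=
  div_pos (Real.sqrt_pos.2 h.four_ac_sub_sq_pos) (by linarith [h.c_pos])

/-- **Completing the square (MV Exercise 25 (a)) as an identity of forms**: for
`z = (b + i√D)/(2c)`, `D = 4ac − b²`, one has `Q(m, n) = (√D/2) · |mz + n|²/Im z = (√D/2) Q_z(m, n)`.
[cite: MontgomeryVaughan2007, §10.1 Exercise 25 (a)] -/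
theorem bqfEval_eq_mul_qForm (h : IsPosDefForm a b c) (z : ℍ) (hre : z.re = b / (2 * c))
    (him : z.im = Real.sqrt (4 * a * c - b ^ 2) / (2 * c)) (v : Fin 2 → ℤ) :
    bqfEval a b c (v 0, v 1) = Real.sqrt (4 * a * c - b ^ 2) / 2 * Literature.NumberTheory.Automorphic.qForm z v := by
  rw [Literature.NumberTheory.Automorphic.qForm_apply, hre, him]
  have hc := h.c_pos
  have hD := h.four_ac_sub_sq_pos
  set S := Real.sqrt (4 * a * c - b ^ 2) with hS
  have hsq : S ^ 2 = 4 * a * c - b ^ 2 := Real.sq_sqrt hD.le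
  have hS0 : 0 < S := Real.sqrt_pos.2 hD
  unfold bqfEval
  simp only
  have e1 : S / 2 * ((((v 0 : ℝ) * (b / (2 * c)) + (v 1 : ℝ)) ^ 2 + (v 0 : ℝ) ^ 2 * (S / (2 * c)) ^ 2) /
      (S / (2 * c))) =
      c * (((v 0 : ℝ) * (b / (2 * c)) + (v 1 : ℝ)) ^ 2) + (v 0 : ℝ) ^ 2 * S ^ 2 / (4 * c) := by
    field_simp
    ring
  rw [e1, hsq]
  field_simp
  ring

/-- The general term: `Q(m,n)^{−s} = (√D/2)^{−s} · Q_z(m,n)^{−s}` off the origin, and both sides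
vanish at the origin (`s ≠ 0`; `0^s = 0`). [folklore] -/
theorem epsteinTerm_eq_mul_qForm_cpow (h : IsPosDefForm a b c) (z : ℍ) (hre : z.re = b / (2 * c))
    (him : z.im = Real.sqrt (4 * a * c - b ^ 2) / (2 * c)) {s : ℂ} (hs : s ≠ 0) (v : Fin 2 → ℤ) :
    epsteinTerm a b c s (v 0, v 1) =
      ((Real.sqrt (4 * a * c - b ^ 2) / 2 : ℝ) : ℂ) ^ (-s) * (1 / ((Literature.NumberTheory.Automorphic.qForm z v : ℝ) : ℂ) ^ s) := by
  unfold epsteinTerm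
  by_cases hv : v = 0
  · subst hv
    simp [Complex.zero_cpow hs]
  · have hv' : ((v 0, v 1) : ℤ × ℤ) ≠ 0 := by
      intro h0
      apply hv
      simp only [Prod.mk_eq_zero] at h0
      ext i
      fin_cases i
      · exact h0.1
      · exact h0.2
    have hS : 0 ≤ Real.sqrt (4 * a * c - b ^ 2) / 2 := by positivity
    rw [if_neg hv', bqfEval_eq_mul_qForm h z hre him v, Complex.ofReal_mul,
      Complex.mul_cpow_ofReal_nonneg hS (Literature.NumberTheory.Automorphic.qForm_nonneg z v)]
    congr 1
    rw [Complex.cpow_neg, one_div]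

/-- **`ζ_Q(s) = (√D/2)^{−s} ∑_v Q_z(v)^{−s}`** (`s ≠ 0`; as `tsum`s, the right side over all of `ℤ²`
with vanishing origin term). [folklore] -/
theorem epsteinZeta_eq_mul_tsum (h : IsPosDefForm a b c) (z : ℍ) (hre : z.re = b / (2 * c))
    (him : z.im = Real.sqrt (4 * a * c - b ^ 2) / (2 * c)) {s : ℂ} (hs : s ≠ 0) :
    epsteinZeta a b c s = ((Real.sqrt (4 * a * c - b ^ 2) / 2 : ℝ) : ℂ) ^ (-s) *
      ∑' v : Fin 2 → ℤ, 1 / ((Literature.NumberTheory.Automorphic.qForm z v : ℝ) : ℂ) ^ s := by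
  unfold epsteinZeta
  rw [← (finTwoArrowEquiv ℤ).tsum_eq, ← tsum_mul_left]
  exact tsum_congr fun v => by
    simpa [finTwoArrowEquiv] using epsteinTerm_eq_mul_qForm_cpow h z hre him hs v

/-! ## The Mellin transform `Λ_z` of `Θ_z − 1` -/

/-- **`Λ_z(s) = π^{−s} Γ(s) ∑_v Q_z(v)^{−s}` for `σ > 1`**: the Mellin transform of `Θ_z − 1`
computed termwise (Mathlib `hasSum_mellin_pi_mul₀`; as in `Literature.NumberTheory.Automorphic.completedEisenstein_eq_theta_mul`,
before sorting by the gcd). [folklore] -/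
theorem thetaFEPair_Λ_eq_tsum (z : ℍ) {s : ℂ} (hs : 1 < s.re) :
    (Literature.NumberTheory.Automorphic.thetaFEPair z).Λ s =
      (Real.pi : ℂ) ^ (-s) * Complex.Gamma s * ∑' v : Fin 2 → ℤ, 1 / ((Literature.NumberTheory.Automorphic.qForm z v : ℝ) : ℂ) ^ s := by
  have hs0 : 0 < s.re := by linarith
  have hM := (Literature.NumberTheory.Automorphic.thetaFEPair z).hasMellin (s := s) (by simpa [Literature.NumberTheory.Automorphic.thetaFEPair] using hs)
  have hF : ∀ t ∈ Set.Ioi (0 : ℝ), HasSum (fun v : Fin 2 → ℤ =>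
      if Literature.NumberTheory.Automorphic.qForm z v = 0 then (0 : ℂ) else 1 * (Real.exp (-Real.pi * Literature.NumberTheory.Automorphic.qForm z v * t) : ℝ))
        ((Literature.NumberTheory.Automorphic.thetaQ z t : ℂ) - 1) :=
    fun t ht => Literature.NumberTheory.Automorphic.hasSum_thetaQ_sub_one z ht
  have hS := hasSum_mellin_pi_mul₀ (a := fun _ : Fin 2 → ℤ => (1 : ℂ)) (fun v => Literature.NumberTheory.Automorphic.qForm_nonneg z v)
    hs0 hF (by simpa using Literature.NumberTheory.Automorphic.summable_one_div_qForm_rpow z hs)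
  have e1 : mellin (fun t => (Literature.NumberTheory.Automorphic.thetaQ z t : ℂ) - 1) s = (Literature.NumberTheory.Automorphic.thetaFEPair z).Λ s := by
    simpa [Literature.NumberTheory.Automorphic.thetaFEPair] using hM.2
  rw [← e1, ← hS.tsum_eq, ← tsum_mul_left]
  exact tsum_congr fun v => by ring

/-- **`Λ_z(s) = π^{−s} Γ(s) (√D/2)^s ζ_Q(s)` for `σ > 1`** (MV Exercise 25 (c) at `z = 1`, left
side: `ξ_Q(s) = ζ_Q(s)Γ(s)(−d)^{s/2}(2π)^{−s}` is the Mellin transform of `ϑ_Q − 1`).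
[cite: MontgomeryVaughan2007, §10.1 Exercise 25 (c)] -/
theorem thetaFEPair_Λ_eq_epsteinZeta (h : IsPosDefForm a b c) (z : ℍ) (hre : z.re = b / (2 * c))
    (him : z.im = Real.sqrt (4 * a * c - b ^ 2) / (2 * c)) {s : ℂ} (hs : 1 < s.re) :
    (Literature.NumberTheory.Automorphic.thetaFEPair z).Λ s = (Real.pi : ℂ) ^ (-s) * Complex.Gamma s *
      ((Real.sqrt (4 * a * c - b ^ 2) / 2 : ℝ) : ℂ) ^ s * epsteinZeta a b c s := by
  have hs0 : s ≠ 0 := fun h0 => by rw [h0, Complex.zero_re] at hs; linarith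
  have hS0 : ((Real.sqrt (4 * a * c - b ^ 2) / 2 : ℝ) : ℂ) ≠ 0 := by
    have := h.four_ac_sub_sq_pos
    exact_mod_cast (by positivity : Real.sqrt (4 * a * c - b ^ 2) / 2 ≠ 0)
  set x : ℂ := ((Real.sqrt (4 * a * c - b ^ 2) / 2 : ℝ) : ℂ) with hx
  have hxs : x ^ s * x ^ (-s) = 1 := by
    rw [Complex.cpow_neg, mul_inv_cancel₀]
    exact Complex.cpow_ne_zero_iff.2 (Or.inl hS0)
  rw [thetaFEPair_Λ_eq_tsum z hs, epsteinZeta_eq_mul_tsum h z hre him hs0]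
  calc (Real.pi : ℂ) ^ (-s) * Complex.Gamma s * ∑' v : Fin 2 → ℤ, 1 / ((Literature.NumberTheory.Automorphic.qForm z v : ℝ) : ℂ) ^ s
      = (Real.pi : ℂ) ^ (-s) * Complex.Gamma s * (x ^ s * x ^ (-s)) *
          ∑' v : Fin 2 → ℤ, 1 / ((Literature.NumberTheory.Automorphic.qForm z v : ℝ) : ℂ) ^ s := by rw [hxs, mul_one]
    _ = _ := by ring

/-- `Λ_z = Λ₀ − 1/s − 1/(1 − s)` with `Λ₀` entire (the pole structure of a weak FE-pair with
`k = 1`, `ε = 1`, `f₀ = g₀ = 1`). [folklore] -/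
theorem thetaFEPair_Λ_eq_Λ₀ (z : ℍ) (s : ℂ) :
    (Literature.NumberTheory.Automorphic.thetaFEPair z).Λ s = (Literature.NumberTheory.Automorphic.thetaFEPair z).Λ₀ s - 1 / s - 1 / (1 - s) := by
  rw [WeakFEPair.Λ]
  simp only [Literature.NumberTheory.Automorphic.thetaFEPair, smul_eq_mul, mul_one, Complex.ofReal_one, one_div]

/-- **`Λ_z(1 − s) = Λ_z(s)`** (the functional equation of the self-dual pair `Θ_z`; MV Exercise
25 (b) ⇒ (e)). [cite: MontgomeryVaughan2007, §10.1 Exercise 25 (e)] -/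
theorem thetaFEPair_Λ_one_sub (z : ℍ) (s : ℂ) :
    (Literature.NumberTheory.Automorphic.thetaFEPair z).Λ (1 - s) = (Literature.NumberTheory.Automorphic.thetaFEPair z).Λ s := by
  have h := (Literature.NumberTheory.Automorphic.thetaFEPair z).functional_equation s
  rw [Literature.NumberTheory.Automorphic.thetaFEPair_symm] at h
  simpa [Literature.NumberTheory.Automorphic.thetaFEPair] using h

/-- **Normalisation of the completing factors**: `π^s (√D/2)^{−s} D^{s/2} (2π)^{−s} = 1` (`D > 0`),
i.e. MV's `(−d)^{s/2}(2π)^{−s}` equals `π^{−s}(√D/2)^{s}`. [folklore] -/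
theorem cpow_normalisation {D : ℝ} (hD : 0 < D) (s : ℂ) :
    (Real.pi : ℂ) ^ s * ((Real.sqrt D / 2 : ℝ) : ℂ) ^ (-s) * ((D : ℝ) : ℂ) ^ (s / 2) *
      ((2 * Real.pi : ℝ) : ℂ) ^ (-s) = 1 := by
  have hπ := Real.pi_pos
  have hSD : 0 < Real.sqrt D / 2 := by positivity
  have h2π : 0 < 2 * Real.pi := by positivity
  rw [Complex.cpow_def_of_ne_zero (by exact_mod_cast hπ.ne'),
    Complex.cpow_def_of_ne_zero (by exact_mod_cast hSD.ne'),
    Complex.cpow_def_of_ne_zero (by exact_mod_cast hD.ne'),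
    Complex.cpow_def_of_ne_zero (by exact_mod_cast h2π.ne'), ← Complex.exp_add, ← Complex.exp_add,
    ← Complex.exp_add, ← Complex.ofReal_log hπ.le, ← Complex.ofReal_log hSD.le,
    ← Complex.ofReal_log hD.le, ← Complex.ofReal_log h2π.le,
    Real.log_div (Real.sqrt_pos.2 hD).ne' two_ne_zero, Real.log_sqrt hD.le,
    Real.log_mul two_ne_zero hπ.ne']
  convert Complex.exp_zero using 2
  push_cast
  ring

/-! ## The discharge -/

/-- **Discharge of `MontgomeryVaughan2007_epsteinContinuation`** (MV §10.1 Exercise 25 (d), (e)):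
for every positive definite real binary form `Q` there is `Z` holomorphic on `ℂ ∖ {1}`, equal to
`ζ_Q` on `σ > 1`, with `ξ_Q(s) = ξ_Q(1 − s)` for all non-integer `s`, where
`ξ_Q(s) = Z(s)Γ(s)(−d)^{s/2}(2π)^{−s}`. The witness is
`Z(s) = π^s(√D/2)^{−s}[(Λ₀(s) − 1/(1−s))Γ(s)⁻¹ − Γ(s+1)⁻¹]` built from the Mellin transform
`Λ = Λ₀ − 1/s − 1/(1−s)` of `Θ_{z_Q} − 1`, `z_Q = (b + i√D)/(2c)`.
[cite: MontgomeryVaughan2007, §10.1 Exercise 25 (d), (e)] -/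
theorem MontgomeryVaughan2007_epsteinContinuation_holds : MontgomeryVaughan2007_epsteinContinuation := by
  intro a b c h
  have hc := h.c_pos
  have hD := h.four_ac_sub_sq_pos
  have hS2 : 0 < Real.sqrt (4 * a * c - b ^ 2) / 2 := by positivity
  have hS2c : ((Real.sqrt (4 * a * c - b ^ 2) / 2 : ℝ) : ℂ) ≠ 0 := by exact_mod_cast hS2.ne'
  have hπc : (Real.pi : ℂ) ≠ 0 := by exact_mod_cast Real.pi_pos.ne'
  obtain ⟨z, hre, him⟩ : ∃ z : ℍ, z.re = b / (2 * c) ∧ z.im = Real.sqrt (4 * a * c - b ^ 2) / (2 * c) :=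
    ⟨⟨⟨b / (2 * c), Real.sqrt (4 * a * c - b ^ 2) / (2 * c)⟩, h.sqrt_div_pos⟩, rfl, rfl⟩
  -- the witness
  set Z : ℂ → ℂ := fun s => (Real.pi : ℂ) ^ s * ((Real.sqrt (4 * a * c - b ^ 2) / 2 : ℝ) : ℂ) ^ (-s) *
    (((Literature.NumberTheory.Automorphic.thetaFEPair z).Λ₀ s - 1 / (1 - s)) * (Complex.Gamma s)⁻¹ - (Complex.Gamma (s + 1))⁻¹)
    with hZdef
  -- off the zeros of `Γ` (and `s ≠ 0, 1`): `Z(s) = π^s (√D/2)^{-s} Γ(s)⁻¹ Λ_z(s)`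
  have hZ : ∀ s : ℂ, s ≠ 0 → s ≠ 1 → Complex.Gamma s ≠ 0 →
      Z s = (Real.pi : ℂ) ^ s * ((Real.sqrt (4 * a * c - b ^ 2) / 2 : ℝ) : ℂ) ^ (-s) *
        (Complex.Gamma s)⁻¹ * (Literature.NumberTheory.Automorphic.thetaFEPair z).Λ s := by
    intro s hs0 hs1 hΓ
    have h1s : (1 : ℂ) - s ≠ 0 := sub_ne_zero.2 (Ne.symm hs1)
    simp only [hZdef]
    rw [thetaFEPair_Λ_eq_Λ₀, Complex.Gamma_add_one s hs0]
    field_simp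
    ring
  refine ⟨Z, ⟨?_, ?_⟩, ?_⟩
  · -- holomorphy on `ℂ ∖ {1}`
    intro s hs
    have hs' : (1 : ℂ) - s ≠ 0 := sub_ne_zero.2 (Ne.symm hs)
    apply DifferentiableAt.differentiableWithinAt
    simp only [hZdef]
    have hE1 : DifferentiableAt ℂ (fun s : ℂ => (Real.pi : ℂ) ^ s) s :=
      differentiableAt_id.const_cpow (Or.inl hπc)
    have hE2 : DifferentiableAt ℂ
        (fun s : ℂ => ((Real.sqrt (4 * a * c - b ^ 2) / 2 : ℝ) : ℂ) ^ (-s)) s :=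
      differentiableAt_id.neg.const_cpow (Or.inl hS2c)
    have hΛ₀ : DifferentiableAt ℂ (Literature.NumberTheory.Automorphic.thetaFEPair z).Λ₀ s := (Literature.NumberTheory.Automorphic.thetaFEPair z).differentiable_Λ₀ s
    have h1 : DifferentiableAt ℂ (fun s : ℂ => 1 / (1 - s)) s :=
      (differentiableAt_const 1).div ((differentiableAt_const 1).sub differentiableAt_id) hs'
    have hG : DifferentiableAt ℂ (fun s : ℂ => (Complex.Gamma s)⁻¹) s :=
      Complex.differentiable_one_div_Gamma s
    have hG1 : DifferentiableAt ℂ (fun s : ℂ => (Complex.Gamma (s + 1))⁻¹) s :=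
      (Complex.differentiable_one_div_Gamma.comp (differentiable_id.add_const 1)) s
    exact (hE1.mul hE2).mul (((hΛ₀.sub h1).mul hG).sub hG1)
  · -- agreement with `ζ_Q` on `σ > 1`
    intro s hs
    have hs0 : s ≠ 0 := fun h0 => by rw [h0, Complex.zero_re] at hs; linarith
    have hs1 : s ≠ 1 := fun h1 => by rw [h1, Complex.one_re] at hs; linarith
    have hΓ : Complex.Gamma s ≠ 0 := Complex.Gamma_ne_zero_of_re_pos (by linarith)
    set x : ℂ := ((Real.sqrt (4 * a * c - b ^ 2) / 2 : ℝ) : ℂ) with hx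
    have hxs : x ^ (-s) * x ^ s = 1 := by
      rw [Complex.cpow_neg, inv_mul_cancel₀]
      exact Complex.cpow_ne_zero_iff.2 (Or.inl hS2c)
    have hπs : (Real.pi : ℂ) ^ s * (Real.pi : ℂ) ^ (-s) = 1 := by
      rw [Complex.cpow_neg, mul_inv_cancel₀]
      exact Complex.cpow_ne_zero_iff.2 (Or.inl hπc)
    rw [hZ s hs0 hs1 hΓ, thetaFEPair_Λ_eq_epsteinZeta h z hre him hs]
    calc (Real.pi : ℂ) ^ s * x ^ (-s) * (Complex.Gamma s)⁻¹ *
          ((Real.pi : ℂ) ^ (-s) * Complex.Gamma s * x ^ s * epsteinZeta a b c s)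
        = ((Real.pi : ℂ) ^ s * (Real.pi : ℂ) ^ (-s)) * (x ^ (-s) * x ^ s) *
            ((Complex.Gamma s)⁻¹ * Complex.Gamma s) * epsteinZeta a b c s := by ring
      _ = epsteinZeta a b c s := by rw [hπs, hxs, inv_mul_cancel₀ hΓ]; ring
  · -- the functional equation at non-integers
    have key : ∀ w : ℂ, (∀ n : ℤ, w ≠ n) → epsteinXi a b c Z w = (Literature.NumberTheory.Automorphic.thetaFEPair z).Λ w := by
      intro w hw
      have hw0 : w ≠ 0 := by simpa using hw 0
      have hw1 : w ≠ 1 := by simpa using hw 1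
      have hΓ : Complex.Gamma w ≠ 0 :=
        Complex.Gamma_ne_zero fun m => by simpa using hw (-m)
      unfold epsteinXi
      rw [hZ w hw0 hw1 hΓ]
      calc (Real.pi : ℂ) ^ w * ((Real.sqrt (4 * a * c - b ^ 2) / 2 : ℝ) : ℂ) ^ (-w) *
            (Complex.Gamma w)⁻¹ * (Literature.NumberTheory.Automorphic.thetaFEPair z).Λ w * Complex.Gamma w *
            ((4 * a * c - b ^ 2 : ℝ) : ℂ) ^ (w / 2) * ((2 * Real.pi : ℝ) : ℂ) ^ (-w)
          = (Literature.NumberTheory.Automorphic.thetaFEPair z).Λ w * ((Complex.Gamma w)⁻¹ * Complex.Gamma w) *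
            ((Real.pi : ℂ) ^ w * ((Real.sqrt (4 * a * c - b ^ 2) / 2 : ℝ) : ℂ) ^ (-w) *
              ((4 * a * c - b ^ 2 : ℝ) : ℂ) ^ (w / 2) * ((2 * Real.pi : ℝ) : ℂ) ^ (-w)) := by ring
        _ = (Literature.NumberTheory.Automorphic.thetaFEPair z).Λ w := by rw [inv_mul_cancel₀ hΓ, cpow_normalisation hD w]; ring
    intro s hs
    have h1s : ∀ n : ℤ, 1 - s ≠ n := fun n hn => hs (1 - n) (by
      push_cast
      rw [← hn]
      ring)
    rw [key s hs, key (1 - s) h1s, thetaFEPair_Λ_one_sub]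

end Literature.Barriers.RiemannHypothesis
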